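import Summits.NavierStokesRegularity.NavierStokesRegularity.Theses.TypeIQuarterGate
import Summits.NavierStokesRegularity.NavierStokesRegularity.Theorems.TypeIQuarterGateLorentzUpgradeOfScarEnvelope
import Summits.NavierStokesRegularity.NavierStokesRegularity.Theorems.TypeIQuarterGateFiniteScarsTypeIOfQuarterLaw
import Summits.NavierStokesRegularity.NavierStokesRegularity.Theorems.TypeIQuarterGateQuarterLawTypeIIffUniformCount
import HarnessLib

/-!
# `TypeIQuarterGate`: modulo the scar envelope, the four Type-I cruxes coincide

By-name DAG closure for the crux `QuarterLawTypeI` (stmt-NavierStokesRegularity-23726) and its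
companions `FiniteScarsTypeI` (23842), `UniformConcentrationCountTypeI` (23970),
`LorentzUpgradeTypeI` (24108), relative to `ScarEnvelopeTypeI` (23843).

Kernel arrows already in the tree:
* `24108 ⟹ 23970` (`CountQuarterLaw.stub_lorentzCount`, p816300) and `23970 ⟹ 23726`
  (`CountQuarterLaw.stub_countQuarterLaw`, p815836), `23726 ⟺ 23970`
  (`CountQuarterLaw.quarterLawTypeI_iff_uniformConcentrationCountTypeI`, p816056);
* `23726 ⟹ 23842` (`finiteScarsTypeI_of_quarterLawTypeI`, p816092);
* `23842 ∧ 23843 ⟹ 24108` (`LorentzOfEnvelope.lorentzUpgradeTypeI_of_scarEnvelope`, p817813).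

Hence, ASSUMING the scar envelope `ScarEnvelopeTypeI` (23843), the cycle
`24108 ⟹ 23726 ⟹ 23842 ⟹ 24108` closes and the four statements are pairwise EQUIVALENT:
`cruxes_tfae_of_scarEnvelope` (a `List.TFAE`), with the named corners
`lorentzUpgradeTypeI_iff_quarterLawTypeI_of_scarEnvelope`,
`finiteScarsTypeI_iff_quarterLawTypeI_of_scarEnvelope`,
`lorentzUpgradeTypeI_iff_finiteScarsTypeI_of_scarEnvelope`.  Reading for the planner: the scar
envelope (23843, «no satellites») is the route's single load-bearing statement beyond which the
Lorentz upgrade, the quarter law, the uniform count and finite scars are one and the same problem;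
WITHOUT 23843 the known arrows are `24108 ⟹ 23726 ⟺ 23970 ⟹ 23842` only.

HONEST FRAMING: compositions of OPEN statements with landed theorems; none of 23726 / 23842 / 23843
/ 23970 / 24108 is proved; nothing about Navier–Stokes regularity or blow-up is claimed. [folklore]
-/

-- the problem directory repeats the summit name (`NavierStokesRegularity/NavierStokesRegularity`)
set_option linter.dupNamespace false

noncomputable section

namespace Summit.NavierStokesRegularity.NavierStokesRegularity.Theorems

namespace LorentzOfEnvelope

open Summit.NavierStokesRegularity.NavierStokesRegularity.Theses.TypeIQuarterGate

/-- **Modulo the scar envelope, the Lorentz upgrade IS the quarter law**: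
`ScarEnvelopeTypeI → (LorentzUpgradeTypeI ↔ QuarterLawTypeI)` (24108 ⟺ 23726 given 23843).
Forward: the Lorentz line (`stub_countQuarterLaw ∘ stub_lorentzCount`); backward: quarter law ⟹ finite
scars (p816092) ⟹ with the envelope, the Lorentz bound (p817813). [folklore] -/
theorem lorentzUpgradeTypeI_iff_quarterLawTypeI_of_scarEnvelope (hS : ScarEnvelopeTypeI) :
    LorentzUpgradeTypeI ↔ QuarterLawTypeI := by
  constructor
  · intro hL ν T hν hT u p hmax hLH hdec hI
    exact CountQuarterLaw.stub_countQuarterLaw ν T hν hT u p hmax hLH hdec hI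
      (CountQuarterLaw.stub_lorentzCount ν T hν hT u p hmax hLH hdec hI
        (hL ν T hν hT u p hmax hLH hdec hI))
  · intro hK
    exact lorentzUpgradeTypeI_of_scarEnvelope (finiteScarsTypeI_of_quarterLawTypeI hK) hS

/-- **Modulo the scar envelope, finite scars IS the quarter law**:
`ScarEnvelopeTypeI → (FiniteScarsTypeI ↔ QuarterLawTypeI)` (23842 ⟺ 23726 given 23843). [folklore] -/
theorem finiteScarsTypeI_iff_quarterLawTypeI_of_scarEnvelope (hS : ScarEnvelopeTypeI) :
    FiniteScarsTypeI ↔ QuarterLawTypeI :=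
  ⟨fun hF => quarterLawTypeI_of_scarEnvelope_via_lorentz hF hS,
    fun hK => finiteScarsTypeI_of_quarterLawTypeI hK⟩

/-- **Modulo the scar envelope, the Lorentz upgrade IS finite scars**:
`ScarEnvelopeTypeI → (LorentzUpgradeTypeI ↔ FiniteScarsTypeI)` (24108 ⟺ 23842 given 23843).
[folklore] -/
theorem lorentzUpgradeTypeI_iff_finiteScarsTypeI_of_scarEnvelope (hS : ScarEnvelopeTypeI) :
    LorentzUpgradeTypeI ↔ FiniteScarsTypeI :=
  (lorentzUpgradeTypeI_iff_quarterLawTypeI_of_scarEnvelope hS).trans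
    (finiteScarsTypeI_iff_quarterLawTypeI_of_scarEnvelope hS).symm

/-- **Modulo the scar envelope the four Type-I cruxes of the route coincide**: given
`ScarEnvelopeTypeI` (23843), the statements `LorentzUpgradeTypeI` (24108), `QuarterLawTypeI` (23726),
`UniformConcentrationCountTypeI` (23970) and `FiniteScarsTypeI` (23842) are pairwise equivalent.
[folklore] -/
theorem cruxes_tfae_of_scarEnvelope (hS : ScarEnvelopeTypeI) :
    [LorentzUpgradeTypeI, QuarterLawTypeI, UniformConcentrationCountTypeI, FiniteScarsTypeI].TFAE := by
  tfae_have 1 ↔ 2 := lorentzUpgradeTypeI_iff_quarterLawTypeI_of_scarEnvelope hS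
  tfae_have 2 ↔ 3 := CountQuarterLaw.quarterLawTypeI_iff_uniformConcentrationCountTypeI
  tfae_have 4 ↔ 2 := finiteScarsTypeI_iff_quarterLawTypeI_of_scarEnvelope hS
  tfae_finish

end LorentzOfEnvelope

end Summit.NavierStokesRegularity.NavierStokesRegularity.Theorems
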